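import Mathlib
import Literature.Combinatorics.SimpleGraph.HamiltonianSubdivision
import Summits.PneNP.PneNP.Theorems.SymmetryBudgetPolylogHamListings

/-!
# Cutting a marked graph: Hamiltonian paths of the cut versus Hamiltonian cycles
(helper for item stmt-PneNP-2148 `SymmetryBudget.PolylogHam`, route route-PneNP-SymmetryBudget)

Towards the Hamiltonian-PATH variant of the linear counting-width bound for Hamiltonicity
(`SymmetryBudgetPolylogHamPathWidth.lean`). For a marked graph `P = ⟨G, a, c, a'⟩`
(`Literature.Combinatorics.SimpleGraph.Marked`: the vertex `a` has exactly the two neighbours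
`c ≠ a'`) the CUT GRAPH is the term

  `(subdivide P.G P.a P.c).deleteEdges {s(none, some P.a)}`

on `Option V`: the edge `a — c` is subdivided by the new vertex `none`, which is then detached
from `a`, so that `none` (pendant at `c`) and `a` (pendant at `a'`) have degree one. Main facts
(`P.Good`, `≥ 3` vertices): `G` is Hamiltonian iff the cut graph has a Hamiltonian PATH, in
listing form — a duplicate-free exhaustive `Adj`-chain (`exists_hamPath_cut_of_isHamiltonian`,
`isHamiltonian_of_hamPath_cut`; degree-one/degree-two forcing, Garey–Johnson–Tarjan 1976, §2),
through the tree's cyclic listings (`IsHamCycleListing`, `ends_of_two_nbrs`,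
`isHamCycleListing_concat_iff`). Also two generic facts on path listings (ends of degree-one
vertices, reversal). Folklore. No definitions are introduced (kernel-only helper file).
-/

-- `Summit.PneNP.PneNP.…` duplicates `PneNP` BY DESIGN (single-problem summit).
set_option linter.dupNamespace false

namespace Summit.PneNP.PneNP.Theorems

namespace PolylogHam

open Literature.Combinatorics.SimpleGraph

variable {α β : Type*}

/-- Hamiltonian-path listings are invariant under graph isomorphisms. -/
theorem exists_hamPath_iff_of_iso {G : SimpleGraph α} {H : SimpleGraph β} (e : G ≃g H) :
    (∃ l : List α, l.Nodup ∧ (∀ v, v ∈ l) ∧ List.IsChain G.Adj l) ↔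
      ∃ l : List β, l.Nodup ∧ (∀ v, v ∈ l) ∧ List.IsChain H.Adj l :=
  ⟨exists_hamPath_of_iso e, exists_hamPath_of_iso e.symm⟩

/-- **A vertex with at most one neighbour is an end of every Hamiltonian path** (listing form):
if `v` occurs in a duplicate-free `R`-chain `l` and `R v x`, `R x v` force `x = w`, then `v` is
the head or the last entry of `l`. -/
theorem eq_head_or_eq_getLast_of_unique_nbr {R : α → α → Prop} {l : List α} (hnd : l.Nodup)
    (hch : List.IsChain R l) {v w : α} (hv : v ∈ l) (hR : ∀ x, R v x → x = w)
    (hR' : ∀ x, R x v → x = w) (hl : l ≠ []) : v = l.head hl ∨ v = l.getLast hl := by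
  obtain ⟨i, hi, rfl⟩ := List.getElem_of_mem hv
  by_cases h0 : i = 0
  · subst h0
    exact Or.inl (List.head_eq_getElem hl).symm
  by_cases hlast : i = l.length - 1
  · subst hlast
    exact Or.inr (List.getLast_eq_getElem hl).symm
  exfalso
  have h1 : R l[i - 1] l[i] := by
    have := List.isChain_iff_getElem.1 hch (i - 1) (by omega)
    simpa only [show i - 1 + 1 = i by omega] using this
  have h2 : R l[i] l[i + 1] := List.isChain_iff_getElem.1 hch i (by omega)
  have e1 : l[i - 1] = w := hR' _ h1
  have e2 : l[i + 1] = w := hR _ h2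
  have := (hnd.getElem_inj_iff).1 (e1.trans e2.symm)
  omega

/-- A reversed Hamiltonian-path listing of a symmetric relation is one. -/
theorem hamPath_reverse {R : α → α → Prop} (hR : ∀ a b, R a b → R b a) {l : List α}
    (hnd : l.Nodup) (hall : ∀ v, v ∈ l) (hch : List.IsChain R l) :
    l.reverse.Nodup ∧ (∀ v, v ∈ l.reverse) ∧ List.IsChain R l.reverse :=
  ⟨List.nodup_reverse.2 hnd, fun v => List.mem_reverse.2 (hall v),
    List.isChain_reverse.2 (List.IsChain.imp (fun a b hab => hR a b hab) hch)⟩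

/-! ### Cutting a marked graph: Hamiltonian paths of the cut versus Hamiltonian cycles -/

section Cut

variable {V : Type*}

/-- Adjacency of the new vertex in the cut graph: only to `c`. -/
theorem cut_adj_none_iff (P : Marked V) (hac : P.a ≠ P.c) (w : Option V) :
    ((subdivide P.G P.a P.c).deleteEdges {s(none, some P.a)}).Adj none w ↔ w = some P.c := by
  rw [SimpleGraph.deleteEdges_adj, subdivide_adj_none_iff, Set.mem_singleton_iff, Sym2.eq_iff]
  constructor
  · rintro ⟨rfl | rfl, h⟩
    · exact (h (Or.inl ⟨rfl, rfl⟩)).elim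
    · rfl
  · rintro rfl
    refine ⟨Or.inr rfl, ?_⟩
    rintro (⟨-, h⟩ | ⟨h, -⟩)
    · exact hac (Option.some_injective _ h).symm
    · cases h

/-- Adjacency of two old vertices in the cut graph: the old edges except `a — c`. -/
theorem cut_adj_some_some (P : Marked V) (x y : V) :
    ((subdivide P.G P.a P.c).deleteEdges {s(none, some P.a)}).Adj (some x) (some y) ↔
      P.G.Adj x y ∧ ¬ (x = P.a ∧ y = P.c) ∧ ¬ (x = P.c ∧ y = P.a) := by
  rw [SimpleGraph.deleteEdges_adj, subdivide_adj_some_some, Set.mem_singleton_iff, Sym2.eq_iff]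
  simp

/-- Adjacency of the marked vertex `a` in the cut graph of a good marked graph: only to `a'`. -/
theorem cut_adj_some_a_iff (P : Marked V) (hP : P.Good) (w : Option V) :
    ((subdivide P.G P.a P.c).deleteEdges {s(none, some P.a)}).Adj (some P.a) w ↔
      w = some P.a' := by
  cases w with
  | none =>
    rw [SimpleGraph.deleteEdges_adj, Set.mem_singleton_iff, Sym2.eq_swap]
    simp
  | some y =>
    rw [cut_adj_some_some, hP.1 y]
    simp only [true_and, Option.some.injEq]
    have hac : P.G.Adj P.a P.c := (hP.1 P.c).2 (Or.inl rfl)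
    constructor
    · rintro ⟨rfl | rfl, h1, -⟩
      · exact (h1 rfl).elim
      · rfl
    · rintro rfl
      exact ⟨Or.inr rfl, fun h => hP.2 h.symm, fun h => hac.ne h.1⟩

variable [Fintype V] [DecidableEq V]

/-- **A Hamiltonian cycle of `P.G` gives a Hamiltonian path of the cut graph** (good marking,
`≥ 3` vertices): rotate a cyclic listing to end in `a`; the rest runs between `c` and `a'`
(`ends_of_two_nbrs`), say from `c` to `a'` after a reversal, and `none, c, …, a', a` is a
Hamiltonian path of the cut graph. -/
theorem exists_hamPath_cut_of_isHamiltonian (P : Marked V) (hP : P.Good)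
    (h3 : 3 ≤ Fintype.card V) (h : P.G.IsHamiltonian) :
    ∃ l : List (Option V), l.Nodup ∧ (∀ v, v ∈ l) ∧
      List.IsChain ((subdivide P.G P.a P.c).deleteEdges {s(none, some P.a)}).Adj l := by
  classical
  have hac : P.G.Adj P.a P.c := (hP.1 P.c).2 (Or.inl rfl)
  obtain ⟨L, hL⟩ := (isHamiltonian_iff_of_three_le_card _ h3).1 h
  -- WLOG the cyclic listing is `M ++ [a]` with `M` from `c` to `a'`
  obtain ⟨M, hLM, hM, hhead, hlast⟩ : ∃ M : List V, IsHamCycleListing P.G.Adj (M ++ [P.a]) ∧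
      ∃ hM : M ≠ [], M.head hM = P.c ∧ M.getLast hM = P.a' := by
    obtain ⟨k, M, hk⟩ := hL.exists_rotate_eq_concat P.a
    have hl : IsHamCycleListing P.G.Adj (M ++ [P.a]) := hk ▸ hL.rotate k
    have hlen : (M ++ [P.a]).length = Fintype.card V := hl.length_eq
    rw [List.length_append, List.length_singleton] at hlen
    have hM : M ≠ [] := List.ne_nil_of_length_pos (by omega)
    rcases ends_of_two_nbrs hM hl (by omega) (fun x hx => (hP.1 x).1 hx)
        (fun x hx => (hP.1 x).1 hx.symm) with ⟨hh, hl'⟩ | ⟨hh, hl'⟩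
    · exact ⟨M, hl, hM, hh, hl'⟩
    · refine ⟨M.reverse, ?_, by simpa using hM, by rw [List.head_reverse, hl'],
        by rw [List.getLast_reverse, hh]⟩
      have h1 := (isHamCycleListing_reverse (fun a b hab => P.G.adj_symm hab) hl).rotate 1
      rwa [List.reverse_append, List.reverse_singleton, List.singleton_append,
        List.rotate_cons_succ, List.rotate_zero] at h1
  obtain ⟨hnd, hall, hch, hlink, -⟩ := (isHamCycleListing_concat_iff hM).1 hLM
  have haM : P.a ∉ M := fun hm => (List.nodup_append'.1 hnd).2.2 hm (List.mem_singleton_self _)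
  refine ⟨none :: (M.map some ++ [some P.a]), ?_, ?_, ?_⟩
  · rw [List.nodup_cons]
    refine ⟨by simp, List.Nodup.append ((List.nodup_append'.1 hnd).1.map (Option.some_injective _))
      (List.nodup_singleton _) ?_⟩
    simp only [List.disjoint_singleton, List.mem_map, Option.some.injEq, exists_eq_right]
    exact haM
  · rintro (_ | v)
    · exact List.mem_cons_self
    · refine List.mem_cons_of_mem _ ?_
      by_cases hv : v = P.a
      · subst hv; simp
      · have : v ∈ M := by
          have := hall v
          rw [List.mem_append, List.mem_singleton] at this
          exact this.resolve_right hv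
        exact List.mem_append_left _ (List.mem_map_of_mem this)
  · rw [List.isChain_cons]
    refine ⟨fun y hy => ?_, List.IsChain.append ?_ (List.isChain_singleton _) ?_⟩
    · -- `none — c`
      have hy' : y = some (M.head hM) := by
        rw [List.head?_append_of_ne_nil _ (by simpa using hM), List.head?_map,
          List.head?_eq_some_head hM] at hy
        simpa using hy.symm
      rw [hy', hhead, cut_adj_none_iff P hac.ne]
    · -- the old path
      rw [List.isChain_map]
      refine List.IsChain.imp_of_mem_imp ?_ hch
      intro x y hx hy hxy
      rw [cut_adj_some_some]
      exact ⟨hxy, fun e => haM (e.1 ▸ hx), fun e => haM (e.2 ▸ hy)⟩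
    · -- `a' — a`
      intro x hx y hy
      rw [List.getLast?_eq_some_getLast (by simpa using hM), Option.mem_def, Option.some.injEq] at hx
      rw [List.head?_cons, Option.mem_def, Option.some.injEq] at hy
      subst hx hy
      rw [List.getLast_map, hlast, SimpleGraph.adj_comm, cut_adj_some_a_iff P hP]

/-- **A Hamiltonian path of the cut graph gives a Hamiltonian cycle of `P.G`** (good marking,
`≥ 3` vertices): the degree-one vertices `none` and `a` are the two ends of the path, which
therefore reads `none, c, …, a', a`; closing up `c, …, a', a` through the edge `a — c` gives a
cyclic listing of `P.G`. -/
theorem isHamiltonian_of_hamPath_cut (P : Marked V) (hP : P.Good) (h3 : 3 ≤ Fintype.card V)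
    (h : ∃ l : List (Option V), l.Nodup ∧ (∀ v, v ∈ l) ∧
      List.IsChain ((subdivide P.G P.a P.c).deleteEdges {s(none, some P.a)}).Adj l) :
    P.G.IsHamiltonian := by
  classical
  have hac : P.G.Adj P.a P.c := (hP.1 P.c).2 (Or.inl rfl)
  set Γ := (subdivide P.G P.a P.c).deleteEdges {s(none, some P.a)} with hΓ
  -- WLOG the path starts at `none`
  obtain ⟨l, hnd, hall, hch, hl, hhead⟩ : ∃ l : List (Option V), l.Nodup ∧ (∀ v, v ∈ l) ∧
      List.IsChain Γ.Adj l ∧ ∃ hl : l ≠ [], l.head hl = none := by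
    obtain ⟨l, hnd, hall, hch⟩ := h
    have hl : l ≠ [] := List.ne_nil_of_mem (hall none)
    rcases eq_head_or_eq_getLast_of_unique_nbr hnd hch (hall none)
        (fun x hx => (cut_adj_none_iff P hac.ne x).1 hx)
        (fun x hx => (cut_adj_none_iff P hac.ne x).1 hx.symm) hl with h0 | h0
    · exact ⟨l, hnd, hall, hch, hl, h0.symm⟩
    · obtain ⟨h1, h2, h3'⟩ := hamPath_reverse (fun a b hab => Γ.adj_symm hab) hnd hall hch
      exact ⟨l.reverse, h1, h2, h3', by simpa using hl, by rw [List.head_reverse, ← h0]⟩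
  have hlen : l.length = Fintype.card V + 1 := by
    have huniv : l.toFinset = Finset.univ :=
      Finset.eq_univ_iff_forall.2 fun v => List.mem_toFinset.2 (hall v)
    rw [← List.toFinset_card_of_nodup hnd, huniv, Finset.card_univ, Fintype.card_option]
  -- all later entries are old vertices
  have hl0 : l[0]'(by omega) = none := by rw [← List.head_eq_getElem hl]; exact hhead
  have hsome : ∀ (i : ℕ) (hi : i + 1 < l.length), (l[i + 1]).isSome = true := by
    intro i hi
    by_contra hne
    rw [Bool.not_eq_true, Option.isSome_eq_false_iff, Option.isNone_iff_eq_none] at hne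
    have := (hnd.getElem_inj_iff).1 (hne.trans hl0.symm)
    omega
  -- the second entry is `c`, the last is `a`
  have hl1 : l[1]'(by omega) = some P.c := by
    have := List.isChain_iff_getElem.1 hch 0 (by omega)
    rw [hl0] at this
    exact (cut_adj_none_iff P hac.ne _).1 this
  have hlast : l[l.length - 1]'(by omega) = some P.a := by
    have ha : some P.a ∈ l := hall _
    rcases eq_head_or_eq_getLast_of_unique_nbr hnd hch ha
        (fun x hx => (cut_adj_some_a_iff P hP x).1 hx)
        (fun x hx => (cut_adj_some_a_iff P hP x).1 hx.symm) hl with h0 | h0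
    · rw [hhead] at h0; exact (Option.some_ne_none _ h0).elim
    · rw [List.getLast_eq_getElem] at h0; exact h0.symm
  -- the cyclic listing of the old vertices
  set N := Fintype.card V with hN
  let f : Fin N → V := fun i => (l[(i : ℕ) + 1]'(by have := i.2; omega)).get (hsome i (by
    have := i.2; omega))
  have hf : ∀ i : Fin N, some (f i) = l[(i : ℕ) + 1]'(by have := i.2; omega) := fun i =>
    Option.some_get _
  have hL : IsHamCycleListing P.G.Adj ((List.finRange N).map f) := by
    refine ⟨(List.nodup_finRange N).map fun i j hij => ?_, fun v => ?_, fun i hi => ?_⟩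
    · have h1 := hf i
      rw [hij, hf j] at h1
      have := (hnd.getElem_inj_iff).1 h1
      exact Fin.ext (by omega)
    · obtain ⟨i, hi, hiv⟩ := List.getElem_of_mem (hall (some v))
      have hi0 : i ≠ 0 := by rintro rfl; rw [hl0] at hiv; cases hiv
      rw [List.mem_map]
      refine ⟨⟨i - 1, by omega⟩, List.mem_finRange _, Option.some_injective _ ?_⟩
      rw [hf]
      simp only [show i - 1 + 1 = i by omega, hiv]
    · rw [List.length_map, List.length_finRange] at hi
      have key : ∀ u v : Fin N, Γ.Adj (l[(u : ℕ) + 1]'(by have := u.2; omega))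
          (l[(v : ℕ) + 1]'(by have := v.2; omega)) → P.G.Adj (f u) (f v) := by
        intro u v huv
        rw [← hf, ← hf] at huv
        exact ((cut_adj_some_some P _ _).1 huv).1
      simp only [List.getElem_map, List.getElem_finRange, List.length_map, List.length_finRange]
      change P.G.Adj (f ⟨i, hi⟩) (f ⟨(i + 1) % N, Nat.mod_lt _ (by omega)⟩)
      by_cases hlt : i + 1 < N
      · have e : (⟨(i + 1) % N, Nat.mod_lt _ (by omega)⟩ : Fin N) = ⟨i + 1, hlt⟩ :=
          Fin.ext (Nat.mod_eq_of_lt hlt)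
        rw [e]
        exact key ⟨i, hi⟩ ⟨i + 1, hlt⟩ (List.isChain_iff_getElem.1 hch (i + 1) (by omega))
      · -- the wrap-around pair `a — c`
        have hi' : i = N - 1 := by omega
        subst hi'
        have e : (⟨(N - 1 + 1) % N, Nat.mod_lt _ (by omega)⟩ : Fin N) = ⟨0, by omega⟩ :=
          Fin.ext (by simp only [Nat.sub_add_cancel (show 1 ≤ N by omega), Nat.mod_self])
        rw [e]
        have ha : f ⟨N - 1, hi⟩ = P.a := Option.some_injective _ (by
          rw [hf]
          have hidx : ((⟨N - 1, hi⟩ : Fin N) : ℕ) + 1 = l.length - 1 := by simp only; omega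
          simp only [hidx, hlast])
        have hc : f ⟨0, by omega⟩ = P.c := Option.some_injective _ (by
          rw [hf]
          have hidx : ((⟨0, by omega⟩ : Fin N) : ℕ) + 1 = 1 := rfl
          simp only [hidx, hl1])
        rw [ha, hc]
        exact hac
  exact (isHamiltonian_iff_of_three_le_card _ h3).2 ⟨_, hL⟩

end Cut

end PolylogHam

end Summit.PneNP.PneNP.Theorems
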